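import Mathlib.Analysis.SpecialFunctions.Complex.LogDeriv
import Mathlib.Analysis.SpecialFunctions.Complex.Arg
import Mathlib.Analysis.SpecialFunctions.Integrals.Basic
import Mathlib.Analysis.SpecialFunctions.ImproperIntegrals
import Mathlib.MeasureTheory.Integral.IntervalIntegral.FundThmCalculus
import Mathlib.MeasureTheory.Integral.Prod
import Mathlib.Analysis.Calculus.ParametricIntegral
import HarnessLib

/-!
# RH-FREE · arc lemmas for Wang's criterion: the functional `u ↦ ∫_{-π/2}^{π/2} cos θ (∂_r u + u)(e^{iθ}) dθ` on `log|z − c|` and on half-plane Poisson integrals — nothing here bears on the truth of RH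

Pure real/complex analysis (no zeta function) serving the discharge of the named fact
`Literature.NumberTheory.LFunctions.Wang1946_criterion` (F. T. Wang, Bull. AMS 52 (1946); Broughan,
*Equivalents of the Riemann Hypothesis* Vol. 2, §8.1 p. 127), file `WangCriterionProofs.lean`.

Wang's formula is Carleman's theorem for `ζ(1/2 + z)` on `{Re z > 0, |z| > 1}`; its inner-arc term is
the functional

  `Arc[u] = ∫_{-π/2}^{π/2} cos θ · (∂_r u(e^{iθ}) + u(e^{iθ})) dθ`

of `u = log|ζ(1/2 + z)|`. The tree's road to Wang's identity (a recorded DEVIATION from the printed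
contour-integral proof, see `WangCriterionProofs`) decomposes `log|ζ(1/2+z)|` on the right half-plane
into a Poisson integral, two logarithms `log|z ± 1/2|` and a Blaschke sum over the off-line zeros, and
evaluates `Arc` on each piece. This file supplies those evaluations:

* §1 the master identity (integration by parts along the arc): for `G` differentiable,
  `∫ cos θ (Im G' + Re G) = ∫ Re(e^{-iθ} G) + [cos θ · Im G]` (`arc_master_identity`);
* §2 `∫_{-π/2}^{π/2} e^{-iθ} Log(e^{iθ} − c) dθ` in closed form (`integral_exp_neg_mul_log_exp_sub`) and
  hence `Arc[log|· − c|]` (`arcLog_eq`);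
* §3 the two pair identities used by Wang's formula: the Blaschke pair
  `Arc[log|· + conj ζ| − log|· − ζ|] = 2π Re ζ/|ζ|²` for `Re ζ > 0`, `|Im ζ| > 1` (`arcLog_blaschke_pair`),
  and the pole pair `Arc[log|· + 1/2| − log|· − 1/2|] = 0` (`arcLog_pole_pair`);
* §4 the half-plane Poisson kernel `P(z, t) = (1/π) Re(1/(z − it))` (written out explicitly, no
  definition is introduced), its radial derivative `(1/π) Re(−e/(z − it)²)` along the ray through `e`,
  and the arc kernel `K(t) = ∫ cos θ (∂_r P + P)(e^{iθ}, t) dθ = 1_{|t|>1}/t²` (private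
  `integral_arcKernel`);
* §5 by Fubini and differentiation under the integral sign, `Arc[Poisson[g]] = ∫_{|t|>1} g(t)/t² dt`
  for every `g` with `g/(1+t²) ∈ L¹` bounded on `[−2, 2]` (`arc_poissonIntegral_eq`,
  `hasDerivAt_poissonIntegral`).

No `def`, no named fact: theorems only. Everything is classical calculus (Carleman's theorem: Titchmarsh, *Theory of Functions* §3.7; the
arc kernel identity is the balayage of `cos θ (∂_r + 1)` on the unit semicircle onto the imaginary
axis). RH-FREE: no statement here mentions `ζ`.

## References

* [Wang1946] F. T. Wang, *A note on the Riemann zeta-function*, Bull. Amer. Math. Soc. 52 (1946)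
  319–321 (Lemma = Carleman's theorem for the unit semicircle and a rectangle).
* [Titchmarsh1939] E. C. Titchmarsh, *The Theory of Functions*, 2nd ed., OUP 1939, §3.71
  (Carleman's theorem).
* [AxlerBourdonRamey2001] S. Axler, P. Bourdon, W. Ramey, *Harmonic Function Theory*, 2nd ed.,
  GTM 137, Ch. 7 (harmonic functions on half-spaces; the Poisson kernel `P_H`).
-/

noncomputable section

open Complex Set Filter MeasureTheory Real intervalIntegral
open scoped Topology ComplexConjugate

namespace Literature.NumberTheory.LFunctions

namespace WangArc

/-! ### §0 Calculus of `θ ↦ e^{iθ}` -/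

/-- `θ ↦ e^{iθ}` has derivative `i e^{iθ}`. [folklore] -/
private theorem hasDerivAt_expI (θ : ℝ) :
    HasDerivAt (fun θ : ℝ ↦ cexp (θ * I)) (I * cexp (θ * I)) θ := by
  have h : HasDerivAt (fun θ : ℝ ↦ (θ : ℂ) * I) ((1 : ℂ) * I) θ :=
    (hasDerivAt_id θ).ofReal_comp.mul_const I
  have := h.cexp
  simpa [mul_comm] using this

/-- `θ ↦ e^{-iθ}` has derivative `-i e^{-iθ}`. [folklore] -/
private theorem hasDerivAt_expNegI (θ : ℝ) :
    HasDerivAt (fun θ : ℝ ↦ cexp (-(θ * I))) (-I * cexp (-(θ * I))) θ := by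
  have h : HasDerivAt (fun θ : ℝ ↦ -((θ : ℂ) * I)) (-((1 : ℂ) * I)) θ :=
    ((hasDerivAt_id θ).ofReal_comp.mul_const I).neg
  have := h.cexp
  simpa [mul_comm] using this

/-- `e^{iθ} = cos θ + i sin θ`: real part. [folklore] -/
private theorem expI_re (θ : ℝ) : (cexp (θ * I)).re = Real.cos θ :=
  Complex.exp_ofReal_mul_I_re θ

/-- `e^{iθ} = cos θ + i sin θ`: imaginary part. [folklore] -/
private theorem expI_im (θ : ℝ) : (cexp (θ * I)).im = Real.sin θ :=
  Complex.exp_ofReal_mul_I_im θ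

/-- `e^{-iθ} = cos θ − i sin θ`: real part. [folklore] -/
private theorem expNegI_re (θ : ℝ) : (cexp (-(θ * I))).re = Real.cos θ := by
  rw [show -((θ : ℂ) * I) = ((-θ : ℝ) : ℂ) * I by push_cast; ring, expI_re, Real.cos_neg]

/-- `e^{-iθ} = cos θ − i sin θ`: imaginary part. [folklore] -/
private theorem expNegI_im (θ : ℝ) : (cexp (-(θ * I))).im = -Real.sin θ := by
  rw [show -((θ : ℂ) * I) = ((-θ : ℝ) : ℂ) * I by push_cast; ring, expI_im, Real.sin_neg]

/-- `‖e^{iθ}‖ = 1`. [folklore] -/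
private theorem norm_expI (θ : ℝ) : ‖cexp (θ * I)‖ = 1 := by
  rw [Complex.norm_exp_ofReal_mul_I]

/-- `e^{iθ} ≠ 0`. [folklore] -/
private theorem expI_ne_zero (θ : ℝ) : cexp (θ * I) ≠ 0 := Complex.exp_ne_zero _

/-- `e^{-iθ} · e^{iθ} = 1`. [folklore] -/
private theorem expNegI_mul_expI (θ : ℝ) : cexp (-(θ * I)) * cexp (θ * I) = 1 := by
  rw [← Complex.exp_add]; simp

/-- `e^{iπ/2} = i`. [folklore] -/
private theorem expI_pi_div_two : cexp (((π / 2 : ℝ) : ℂ) * I) = I := by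
  push_cast
  rw [Complex.exp_mul_I, Complex.cos_pi_div_two, Complex.sin_pi_div_two]
  simp

/-- `e^{-iπ/2} = -i` (exponent written `-(π/2 · i)`). [folklore] -/
private theorem expNegI_pi_div_two : cexp (-(((π / 2 : ℝ) : ℂ) * I)) = -I := by
  push_cast
  rw [← neg_mul, Complex.exp_mul_I, Complex.cos_neg, Complex.sin_neg, Complex.cos_pi_div_two,
    Complex.sin_pi_div_two]
  simp

/-- `e^{-iπ/2} = -i` (exponent written `(-π/2) · i`). [folklore] -/
private theorem expI_neg_pi_div_two : cexp (((-(π / 2) : ℝ) : ℂ) * I) = -I := by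
  push_cast
  rw [Complex.exp_mul_I, Complex.cos_neg, Complex.sin_neg, Complex.cos_pi_div_two,
    Complex.sin_pi_div_two]
  simp

/-- `e^{iπ/2} = i` (exponent written `-((-π/2) · i)`). [folklore] -/
private theorem expNegI_neg_pi_div_two : cexp (-(((-(π / 2) : ℝ) : ℂ) * I)) = I := by
  push_cast
  rw [neg_mul, neg_neg, Complex.exp_mul_I, Complex.cos_pi_div_two, Complex.sin_pi_div_two]
  simp

/-- `Re(e^{-iθ} w) = cos θ · Re w + sin θ · Im w`. [folklore] -/
private theorem re_expNegI_mul (θ : ℝ) (w : ℂ) :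
    (cexp (-(θ * I)) * w).re = Real.cos θ * w.re + Real.sin θ * w.im := by
  rw [Complex.mul_re, expNegI_re, expNegI_im]; ring

/-! ### §1 The master identity: integration by parts along the arc -/

/-- **Master identity.** For `G : ℝ → ℂ` continuous on `[a, b]`, differentiable on `(a, b)` with an
integrable derivative `G'`:
`∫_a^b cos θ (Im G'(θ) + Re G(θ)) dθ = ∫_a^b Re(e^{-iθ} G(θ)) dθ + (cos b · Im G(b) − cos a · Im G(a))`
(since `cos θ (Im G' + Re G) = Re(e^{-iθ}G) + (cos θ · Im G)'`). With `G(θ) = g(e^{iθ})`, `g`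
holomorphic, `Im G'` is the radial derivative of `Re g` on the unit circle, so the left side is the
arc functional `∫ cos θ (∂_r + 1)(Re g)(e^{iθ}) dθ` of Carleman's theorem (the term on the small
circle `|z| = ρ` in Titchmarsh's proof). [cite: Titchmarsh1939, §3.71 (Carleman's theorem, the integral over |z| = ρ); Wang1946, Lemma (the unit semicircle K)] -/
theorem arc_master_identity {a b : ℝ} (hab : a ≤ b) {G G' : ℝ → ℂ}
    (hG : ContinuousOn G (Icc a b)) (hd : ∀ θ ∈ Ioo a b, HasDerivAt G (G' θ) θ)
    (hG' : IntervalIntegrable G' volume a b) :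
    ∫ θ in a..b, Real.cos θ * ((G' θ).im + (G θ).re) =
      (∫ θ in a..b, (cexp (-(θ * I)) * G θ).re) +
        (Real.cos b * (G b).im - Real.cos a * (G a).im) := by
  -- `F θ = cos θ · Im G θ`, `F' θ = -sin θ · Im G θ + cos θ · Im G' θ`
  have hFcont : ContinuousOn (fun θ ↦ Real.cos θ * (G θ).im) (Icc a b) :=
    Real.continuous_cos.continuousOn.mul (Complex.continuous_im.comp_continuousOn hG)
  have hFderiv : ∀ θ ∈ Ioo a b, HasDerivAt (fun θ ↦ Real.cos θ * (G θ).im)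
      (-Real.sin θ * (G θ).im + Real.cos θ * (G' θ).im) θ := by
    intro θ hθ
    have h1 : HasDerivAt (fun θ ↦ (G θ).im) (G' θ).im θ := by
      have := Complex.imCLM.hasFDerivAt.comp_hasDerivAt θ (hd θ hθ)
      simpa [Function.comp_def] using this
    exact (Real.hasDerivAt_cos θ).fun_mul h1
  -- interval integrability of the pieces
  have hIcc : ContinuousOn G (uIcc a b) := by rwa [uIcc_of_le hab]
  have hi1 : IntervalIntegrable (fun θ ↦ (cexp (-(θ * I)) * G θ).re) volume a b := by
    refine (ContinuousOn.intervalIntegrable ?_)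
    rw [uIcc_of_le hab]
    refine Complex.continuous_re.comp_continuousOn ?_
    exact ((Complex.continuous_exp.comp
      ((Complex.continuous_ofReal.mul continuous_const).neg)).continuousOn).mul hG
  have hi2 : IntervalIntegrable (fun θ ↦ -Real.sin θ * (G θ).im + Real.cos θ * (G' θ).im)
      volume a b := by
    refine IntervalIntegrable.add ?_ ?_
    · refine ContinuousOn.intervalIntegrable ?_
      rw [uIcc_of_le hab]
      exact Real.continuous_sin.neg.continuousOn.mul (Complex.continuous_im.comp_continuousOn hG)
    · have h : IntervalIntegrable (fun θ ↦ (G' θ).im) volume a b := by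
        rw [intervalIntegrable_iff] at hG' ⊢
        change Integrable (fun θ ↦ (G' θ).im) (volume.restrict (uIoc a b))
        simpa using Complex.imCLM.integrable_comp hG'
      exact h.continuousOn_mul Real.continuous_cos.continuousOn
  have hFTC := intervalIntegral.integral_eq_sub_of_hasDerivAt_of_le hab hFcont hFderiv hi2
  have hsum : ∫ θ in a..b, Real.cos θ * ((G' θ).im + (G θ).re) =
      ∫ θ in a..b, ((cexp (-(θ * I)) * G θ).re +
        (-Real.sin θ * (G θ).im + Real.cos θ * (G' θ).im)) := by
    refine intervalIntegral.integral_congr fun θ _ ↦ ?_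
    simp only [re_expNegI_mul]
    ring
  rw [hsum, intervalIntegral.integral_add hi1 hi2, hFTC]

/-! ### §2 `Arc[log|· − c|]` -/

/-- The derivative of `θ ↦ Log(e^{iθ} − c)` where `e^{iθ} − c` avoids the closed negative real axis.
[folklore] -/
private theorem hasDerivAt_log_expI_sub {c : ℂ} {θ : ℝ} (h : cexp (θ * I) - c ∈ slitPlane) :
    HasDerivAt (fun θ : ℝ ↦ Complex.log (cexp (θ * I) - c))
      (I * cexp (θ * I) / (cexp (θ * I) - c)) θ := by
  have := ((hasDerivAt_expI θ).sub_const c).clog_real h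
  simpa using this

/-- Continuity of `θ ↦ Log(e^{iθ} − c)` on a set where `e^{iθ} − c` avoids the closed negative real
axis. [folklore] -/
private theorem continuousOn_log_expI_sub {c : ℂ} {s : Set ℝ} (h : ∀ θ ∈ s, cexp (θ * I) - c ∈ slitPlane) :
    ContinuousOn (fun θ : ℝ ↦ Complex.log (cexp (θ * I) - c)) s :=
  fun θ hθ ↦ (hasDerivAt_log_expI_sub (h θ hθ)).continuousAt.continuousWithinAt

/-- **`∫_{-π/2}^{π/2} e^{-iθ} Log(e^{iθ} − c) dθ` in closed form** (`c ≠ 0`, `e^{iθ} − c` off the closed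
negative real axis along the closed arc): the antiderivative is
`(i e^{-iθ} − i/c) Log(e^{iθ} − c) − θ/c`, whence the value
`Log(i − c) + Log(−i − c) − (i/c)(Log(i − c) − Log(−i − c)) − π/c`. [folklore] -/
private theorem integral_exp_neg_mul_log_exp_sub {c : ℂ} (hc : c ≠ 0)
    (hsl : ∀ θ ∈ Icc (-(π / 2)) (π / 2), cexp (θ * I) - c ∈ slitPlane) :
    ∫ θ in (-(π / 2))..(π / 2), cexp (-(θ * I)) * Complex.log (cexp (θ * I) - c) =
      Complex.log (I - c) + Complex.log (-I - c) -
        I / c * (Complex.log (I - c) - Complex.log (-I - c)) - π / c := by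
  set Ψ : ℝ → ℂ := fun θ ↦ (I * cexp (-(θ * I)) - I / c) * Complex.log (cexp (θ * I) - c) - θ / c
    with hΨ
  have hpi : -(π / 2) ≤ π / 2 := by linarith [Real.pi_pos]
  have hcont : ContinuousOn Ψ (Icc (-(π / 2)) (π / 2)) := by
    refine ContinuousOn.sub (ContinuousOn.mul ?_ (continuousOn_log_expI_sub hsl)) ?_
    · exact ((continuous_const.mul (Complex.continuous_exp.comp
        ((Complex.continuous_ofReal.mul continuous_const).neg))).sub continuous_const).continuousOn
    · exact (Complex.continuous_ofReal.div_const _).continuousOn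
  have hderiv : ∀ θ ∈ Ioo (-(π / 2)) (π / 2),
      HasDerivAt Ψ (cexp (-(θ * I)) * Complex.log (cexp (θ * I) - c)) θ := by
    intro θ hθ
    have hθ' : θ ∈ Icc (-(π / 2)) (π / 2) := Ioo_subset_Icc_self hθ
    have hw : cexp (θ * I) - c ≠ 0 := by
      intro h0
      have := hsl θ hθ'
      rw [h0] at this
      exact Complex.zero_notMem_slitPlane this
    have h1 : HasDerivAt (fun θ : ℝ ↦ I * cexp (-(θ * I)) - I / c)
        (I * (-I * cexp (-(θ * I)))) θ :=
      ((hasDerivAt_expNegI θ).const_mul I).sub_const _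
    have h2 := hasDerivAt_log_expI_sub (hsl θ hθ')
    have h3 : HasDerivAt (fun θ : ℝ ↦ (θ : ℂ) / c) (1 / c) θ :=
      (hasDerivAt_id θ).ofReal_comp.div_const c |>.congr_deriv (by simp)
    have h := (h1.mul h2).sub h3
    refine h.congr_deriv ?_
    have e1 : cexp (-(θ * I)) * cexp (θ * I) = 1 := expNegI_mul_expI θ
    have hII : I * I = -1 := Complex.I_mul_I
    have key : (I * cexp (-(θ * I)) - I / c) * (I * cexp (θ * I) / (cexp (θ * I) - c)) = 1 / c := by
      have h4 : (I * cexp (-(θ * I)) - I / c) * (I * cexp (θ * I)) = (cexp (θ * I) - c) / c := by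
        have : (I * cexp (-(θ * I)) - I / c) * (I * cexp (θ * I)) =
            (I * I) * (cexp (-(θ * I)) * cexp (θ * I)) - (I * I) * cexp (θ * I) / c := by ring
        rw [this, e1, hII]
        field_simp
        ring
      rw [← mul_div_assoc, h4, div_div, div_eq_div_iff (mul_ne_zero hc hw) hc]
      ring
    rw [key]
    linear_combination (-(cexp (-(θ * I)) * Complex.log (cexp (θ * I) - c))) * hII
  have hint : IntervalIntegrable (fun θ ↦ cexp (-(θ * I)) * Complex.log (cexp (θ * I) - c))
      volume (-(π / 2)) (π / 2) := by
    refine ContinuousOn.intervalIntegrable ?_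
    rw [uIcc_of_le hpi]
    exact (Complex.continuous_exp.comp
      ((Complex.continuous_ofReal.mul continuous_const).neg)).continuousOn.mul
      (continuousOn_log_expI_sub hsl)
  rw [intervalIntegral.integral_eq_sub_of_hasDerivAt_of_le hpi hcont hderiv hint]
  have hII : I * I = -1 := Complex.I_mul_I
  have hΨ1 : Ψ (π / 2) = (1 - I / c) * Complex.log (I - c) - ((π / 2 : ℝ) : ℂ) / c := by
    simp only [hΨ]
    rw [expNegI_pi_div_two, expI_pi_div_two]
    congr 1
    rw [show I * -I = 1 by rw [mul_neg, hII, neg_neg]]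
  have hΨ2 : Ψ (-(π / 2)) = (-1 - I / c) * Complex.log (-I - c) - ((-(π / 2) : ℝ) : ℂ) / c := by
    simp only [hΨ]
    rw [expNegI_neg_pi_div_two, expI_neg_pi_div_two, hII]
  rw [hΨ1, hΨ2]
  push_cast
  ring

/-- **The arc functional of `log|z − c|`**: for `c ≠ 0` with `e^{iθ} − c` off the closed negative real
axis along the closed right unit semicircle,
`∫_{-π/2}^{π/2} cos θ (Re(e^{iθ}/(e^{iθ} − c)) + log|e^{iθ} − c|) dθ = Re J(c)`, `J(c)` the closed form
of `integral_exp_neg_mul_log_exp_sub` (`Re(e^{iθ}/(e^{iθ} − c))` is the radial derivative of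
`log|z − c|` at `z = e^{iθ}`). [folklore] -/
private theorem arcLog_eq {c : ℂ} (hc : c ≠ 0)
    (hsl : ∀ θ ∈ Icc (-(π / 2)) (π / 2), cexp (θ * I) - c ∈ slitPlane) :
    ∫ θ in (-(π / 2))..(π / 2), Real.cos θ *
        ((cexp (θ * I) / (cexp (θ * I) - c)).re + Real.log ‖cexp (θ * I) - c‖) =
      (Complex.log (I - c) + Complex.log (-I - c) -
        I / c * (Complex.log (I - c) - Complex.log (-I - c)) - π / c).re := by
  have hpi : -(π / 2) ≤ π / 2 := by linarith [Real.pi_pos]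
  have hw : ∀ θ ∈ Icc (-(π / 2)) (π / 2), cexp (θ * I) - c ≠ 0 := by
    intro θ hθ h0
    have := hsl θ hθ
    rw [h0] at this
    exact Complex.zero_notMem_slitPlane this
  set G : ℝ → ℂ := fun θ ↦ Complex.log (cexp (θ * I) - c) with hGdef
  set G' : ℝ → ℂ := fun θ ↦ I * cexp (θ * I) / (cexp (θ * I) - c) with hG'def
  have hG : ContinuousOn G (Icc (-(π / 2)) (π / 2)) := continuousOn_log_expI_sub hsl
  have hd : ∀ θ ∈ Ioo (-(π / 2)) (π / 2), HasDerivAt G (G' θ) θ :=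
    fun θ hθ ↦ hasDerivAt_log_expI_sub (hsl θ (Ioo_subset_Icc_self hθ))
  have hec : Continuous fun θ : ℝ ↦ cexp (θ * I) :=
    Complex.continuous_exp.comp (Complex.continuous_ofReal.mul continuous_const)
  have hG'c : ContinuousOn G' (Icc (-(π / 2)) (π / 2)) :=
    ((continuous_const.mul hec).continuousOn).div (hec.continuousOn.sub continuousOn_const) hw
  have hG'i : IntervalIntegrable G' volume (-(π / 2)) (π / 2) :=
    (hG'c.mono (by rw [uIcc_of_le hpi])).intervalIntegrable
  have hMI := arc_master_identity hpi hG hd hG'i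
  rw [Real.cos_pi_div_two, Real.cos_neg, Real.cos_pi_div_two, zero_mul, zero_mul, sub_zero,
    add_zero] at hMI
  have hlhs : ∫ θ in (-(π / 2))..(π / 2), Real.cos θ * ((G' θ).im + (G θ).re) =
      ∫ θ in (-(π / 2))..(π / 2), Real.cos θ *
        ((cexp (θ * I) / (cexp (θ * I) - c)).re + Real.log ‖cexp (θ * I) - c‖) := by
    refine intervalIntegral.integral_congr fun θ _ ↦ ?_
    simp only [hGdef, hG'def, Complex.log_re, mul_div_assoc, Complex.I_mul_im]
  have hint : IntervalIntegrable (fun θ ↦ cexp (-(θ * I)) * G θ) volume (-(π / 2)) (π / 2) := by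
    refine ContinuousOn.intervalIntegrable ?_
    rw [uIcc_of_le hpi]
    exact (Complex.continuous_exp.comp
      ((Complex.continuous_ofReal.mul continuous_const).neg)).continuousOn.mul hG
  have hrhs : ∫ θ in (-(π / 2))..(π / 2), (cexp (-(θ * I)) * G θ).re =
      (∫ θ in (-(π / 2))..(π / 2), cexp (-(θ * I)) * G θ).re := by
    have := intervalIntegral_re hint
    simpa only [RCLike.re_to_complex] using this
  rw [← hlhs, hMI, hrhs, hGdef, integral_exp_neg_mul_log_exp_sub hc hsl]

/-! ### §3 The Blaschke pair and the pole pair -/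

/-- `Log(−w) = Log w − iπ` for `Im w > 0`. [folklore] -/
private theorem log_neg_of_im_pos {w : ℂ} (h : 0 < w.im) : Complex.log (-w) = Complex.log w - π * I := by
  apply Complex.ext
  · simp [Complex.log_re]
  · simp [Complex.log_im, Complex.arg_neg_eq_arg_sub_pi_of_im_pos h]

/-- `Log(−w) = Log w + iπ` for `Im w < 0`. [folklore] -/
private theorem log_neg_of_im_neg {w : ℂ} (h : w.im < 0) : Complex.log (-w) = Complex.log w + π * I := by
  apply Complex.ext
  · simp [Complex.log_re]
  · simp [Complex.log_im, Complex.arg_neg_eq_arg_add_pi_of_im_neg h]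

/-- `arg w ≠ π` when `Re w > 0`. [folklore] -/
private theorem arg_ne_pi_of_re_pos {w : ℂ} (h : 0 < w.re) : Complex.arg w ≠ π := by
  intro hπ
  rw [Complex.arg_eq_pi_iff] at hπ
  linarith [hπ.1]

/-- `arg w ≠ π` when `Im w ≠ 0`. [folklore] -/
private theorem arg_ne_pi_of_im_ne_zero {w : ℂ} (h : w.im ≠ 0) : Complex.arg w ≠ π := by
  intro hπ
  rw [Complex.arg_eq_pi_iff] at hπ
  exact h hπ.2

/-- Integrability of the arc-functional integrand of `log|· − c|` (continuity on the closed arc when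
`e^{iθ} ≠ c` there). [folklore] -/
private theorem intervalIntegrable_arcLog {c : ℂ}
    (hw : ∀ θ ∈ Icc (-(π / 2)) (π / 2), cexp (θ * I) - c ≠ 0) :
    IntervalIntegrable (fun θ : ℝ ↦ Real.cos θ *
        ((cexp (θ * I) / (cexp (θ * I) - c)).re + Real.log ‖cexp (θ * I) - c‖))
      volume (-(π / 2)) (π / 2) := by
  have hpi : -(π / 2) ≤ π / 2 := by linarith [Real.pi_pos]
  refine ContinuousOn.intervalIntegrable ?_
  rw [uIcc_of_le hpi]
  have hec : Continuous fun θ : ℝ ↦ cexp (θ * I) :=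
    Complex.continuous_exp.comp (Complex.continuous_ofReal.mul continuous_const)
  refine Real.continuous_cos.continuousOn.mul (ContinuousOn.add ?_ ?_)
  · exact Complex.continuous_re.comp_continuousOn
      (hec.continuousOn.div (hec.continuousOn.sub continuousOn_const) hw)
  · exact ContinuousOn.log (continuous_norm.comp_continuousOn (hec.continuousOn.sub continuousOn_const))
      fun θ hθ ↦ (norm_pos_iff.2 (hw θ hθ)).ne'

/-- **The Blaschke pair.** For `Re ζ > 0`, `|Im ζ| > 1`:
`Arc[log|· + conj ζ| − log|· − ζ|] = ∫_{-π/2}^{π/2} cos θ (Re(e/(e + ζ̄)) − Re(e/(e − ζ)) + log|e + ζ̄| − log|e − ζ|) dθ = 2π Re ζ/|ζ|²`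
(`e = e^{iθ}`); this is the contribution `2π Re(1/ζ)` of a zero `ζ` of the half-plane Blaschke factor
`(z − ζ)/(z + ζ̄)` to Carleman's sum. [cite: Titchmarsh1939, §3.71 (Carleman's theorem: the term (1/r_k − r_k/R²) cos θ_k of a zero, here R = ∞); Wang1946, Lemma and eq. (8) (the sum 2Σ β_ν/|ρ_ν|²)] -/
theorem arcLog_blaschke_pair {ζ : ℂ} (hre : 0 < ζ.re) (him : 1 < |ζ.im|) :
    ∫ θ in (-(π / 2))..(π / 2), Real.cos θ *
        ((cexp (θ * I) / (cexp (θ * I) + conj ζ)).re - (cexp (θ * I) / (cexp (θ * I) - ζ)).re +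
          (Real.log ‖cexp (θ * I) + conj ζ‖ - Real.log ‖cexp (θ * I) - ζ‖)) =
      2 * π * (ζ.re / ‖ζ‖ ^ 2) := by
  have hζ0 : ζ ≠ 0 := fun h ↦ by rw [h] at hre; simp at hre
  have hζ0' : -conj ζ ≠ 0 := by
    rw [neg_ne_zero]; exact (map_ne_zero_iff _ (RingHom.injective _)).2 hζ0
  have hsin : ∀ θ : ℝ, Real.sin θ - ζ.im ≠ 0 := by
    intro θ h
    have h1 := Real.abs_sin_le_one θ
    rw [sub_eq_zero] at h
    rw [← h] at him
    linarith
  have hsl1 : ∀ θ ∈ Icc (-(π / 2)) (π / 2), cexp (θ * I) - ζ ∈ slitPlane := by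
    intro θ _
    rw [Complex.mem_slitPlane_iff]
    right
    rw [Complex.sub_im, expI_im]
    exact hsin θ
  have hsl2 : ∀ θ ∈ Icc (-(π / 2)) (π / 2), cexp (θ * I) - -conj ζ ∈ slitPlane := by
    intro θ _
    rw [Complex.mem_slitPlane_iff]
    right
    rw [sub_neg_eq_add, Complex.add_im, expI_im, Complex.conj_im, ← sub_eq_add_neg]
    exact hsin θ
  have hw1 : ∀ θ ∈ Icc (-(π / 2)) (π / 2), cexp (θ * I) - ζ ≠ 0 := fun θ hθ h0 ↦ by
    have := hsl1 θ hθ; rw [h0] at this; exact Complex.zero_notMem_slitPlane this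
  have hw2 : ∀ θ ∈ Icc (-(π / 2)) (π / 2), cexp (θ * I) - -conj ζ ≠ 0 := fun θ hθ h0 ↦ by
    have := hsl2 θ hθ; rw [h0] at this; exact Complex.zero_notMem_slitPlane this
  have h1 := arcLog_eq hζ0 hsl1
  have h2 : ∫ θ in (-(π / 2))..(π / 2), Real.cos θ *
        ((cexp (θ * I) / (cexp (θ * I) + conj ζ)).re + Real.log ‖cexp (θ * I) + conj ζ‖) =
      (Complex.log (I - -conj ζ) + Complex.log (-I - -conj ζ) -
        I / -conj ζ * (Complex.log (I - -conj ζ) - Complex.log (-I - -conj ζ)) - π / -conj ζ).re := by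
    rw [← arcLog_eq hζ0' hsl2]
    refine intervalIntegral.integral_congr fun θ _ ↦ ?_
    simp only [sub_neg_eq_add]
  have hi1 := intervalIntegrable_arcLog hw1
  have hi2 : IntervalIntegrable (fun θ : ℝ ↦ Real.cos θ *
        ((cexp (θ * I) / (cexp (θ * I) + conj ζ)).re + Real.log ‖cexp (θ * I) + conj ζ‖))
      volume (-(π / 2)) (π / 2) :=
    (intervalIntegrable_arcLog hw2).congr fun θ _ ↦ by simp only [sub_neg_eq_add]
  have hsplit : ∫ θ in (-(π / 2))..(π / 2), Real.cos θ *
        ((cexp (θ * I) / (cexp (θ * I) + conj ζ)).re - (cexp (θ * I) / (cexp (θ * I) - ζ)).re +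
          (Real.log ‖cexp (θ * I) + conj ζ‖ - Real.log ‖cexp (θ * I) - ζ‖)) =
      (∫ θ in (-(π / 2))..(π / 2), Real.cos θ *
        ((cexp (θ * I) / (cexp (θ * I) + conj ζ)).re + Real.log ‖cexp (θ * I) + conj ζ‖)) -
      ∫ θ in (-(π / 2))..(π / 2), Real.cos θ *
        ((cexp (θ * I) / (cexp (θ * I) - ζ)).re + Real.log ‖cexp (θ * I) - ζ‖) := by
    rw [← intervalIntegral.integral_sub hi2 hi1]
    refine intervalIntegral.integral_congr fun θ _ ↦ ?_
    ring
  rw [hsplit, h1, h2]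
  -- the logarithms at the endpoints
  have hw₁ : 0 < (ζ - I).re := by simpa using hre
  have hw₂ : 0 < (ζ + I).re := by simpa using hre
  have hne : ζ.im ≠ 0 := by
    intro h
    rw [h, abs_zero] at him
    linarith
  have hsame : (0 < (ζ - I).im ∧ 0 < (ζ + I).im) ∨ ((ζ - I).im < 0 ∧ (ζ + I).im < 0) := by
    simp only [Complex.sub_im, Complex.add_im, Complex.I_im]
    rcases lt_or_gt_of_ne hne with h | h
    · right
      rw [abs_of_neg h] at him
      constructor <;> linarith
    · left
      rw [abs_of_pos h] at him
      constructor <;> linarith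
  set E : ℂ := Complex.log (ζ - I) - Complex.log (ζ + I) with hE
  have hΔ1 : Complex.log (I - ζ) - Complex.log (-I - ζ) = E := by
    rw [show I - ζ = -(ζ - I) by ring, show -I - ζ = -(ζ + I) by ring]
    rcases hsame with ⟨ha, hb⟩ | ⟨ha, hb⟩
    · rw [log_neg_of_im_pos ha, log_neg_of_im_pos hb, hE]; ring
    · rw [log_neg_of_im_neg ha, log_neg_of_im_neg hb, hE]; ring
  have hc1 : I - -conj ζ = conj (ζ - I) := by
    rw [map_sub, Complex.conj_I]; ring
  have hc2 : -I - -conj ζ = conj (ζ + I) := by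
    rw [map_add, Complex.conj_I]; ring
  have hΔ2 : Complex.log (I - -conj ζ) - Complex.log (-I - -conj ζ) = conj E := by
    rw [hc1, hc2, Complex.log_conj _ (arg_ne_pi_of_re_pos hw₁),
      Complex.log_conj _ (arg_ne_pi_of_re_pos hw₂), hE, map_sub]
  have hS1 : (Complex.log (I - ζ) + Complex.log (-I - ζ)).re =
      Real.log ‖ζ - I‖ + Real.log ‖ζ + I‖ := by
    rw [Complex.add_re, Complex.log_re, Complex.log_re, show I - ζ = -(ζ - I) by ring,
      show -I - ζ = -(ζ + I) by ring, norm_neg, norm_neg]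
  have hS2 : (Complex.log (I - -conj ζ) + Complex.log (-I - -conj ζ)).re =
      Real.log ‖ζ - I‖ + Real.log ‖ζ + I‖ := by
    rw [Complex.add_re, Complex.log_re, Complex.log_re, hc1, hc2, Complex.norm_conj,
      Complex.norm_conj]
  rw [Complex.sub_re, Complex.sub_re, Complex.sub_re, Complex.sub_re, hS1, hS2, hΔ1, hΔ2]
  -- `Re((I/(-ζ̄)) conj E) = -Re((I/ζ) E)` and `Re(π/(-ζ̄)) = -Re(π/ζ)`
  have hk1 : I / -conj ζ * conj E = conj (I / ζ * E) := by
    rw [map_mul, map_div₀, Complex.conj_I]; ring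
  have hk2 : (π : ℂ) / -conj ζ = -conj ((π : ℂ) / ζ) := by
    rw [map_div₀, Complex.conj_ofReal]; ring
  rw [hk1, hk2, Complex.neg_re, Complex.conj_re, Complex.conj_re]
  have hπζ : ((π : ℂ) / ζ).re = π * (ζ.re / ‖ζ‖ ^ 2) := by
    rw [Complex.div_re, Complex.ofReal_re, Complex.ofReal_im, Complex.normSq_eq_norm_sq]
    ring
  rw [hπζ]
  ring

/-- **The pole pair.** `Arc[log|· + 1/2| − log|· − 1/2|] = 0`: the two logarithms from the pole of `ζ`
(the term `log|z + 1/2| − log|z − 1/2|`, harmonic on `{Re z > 0, |z| > 1/2}` and vanishing on the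
imaginary axis) contribute nothing to Carleman's identity. [cite: Titchmarsh1939, §3.71 (Carleman's theorem applied to the zero-free factor; no interior term)] -/
theorem arcLog_pole_pair :
    ∫ θ in (-(π / 2))..(π / 2), Real.cos θ *
        ((cexp (θ * I) / (cexp (θ * I) + 1 / 2)).re - (cexp (θ * I) / (cexp (θ * I) - 1 / 2)).re +
          (Real.log ‖cexp (θ * I) + 1 / 2‖ - Real.log ‖cexp (θ * I) - 1 / 2‖)) = 0 := by
  have hpi : -(π / 2) ≤ π / 2 := by linarith [Real.pi_pos]
  have hcos : ∀ θ ∈ Icc (-(π / 2)) (π / 2), 0 ≤ Real.cos θ := fun θ hθ ↦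
    Real.cos_nonneg_of_mem_Icc hθ
  have hsl1 : ∀ θ ∈ Icc (-(π / 2)) (π / 2), cexp (θ * I) - 1 / 2 ∈ slitPlane := by
    intro θ hθ
    rw [Complex.mem_slitPlane_iff, Complex.sub_re, Complex.sub_im, expI_re, expI_im]
    by_cases hs : Real.sin θ = 0
    · left
      have hc2 : Real.cos θ ^ 2 = 1 := by nlinarith [Real.sin_sq_add_cos_sq θ]
      have hc1 : Real.cos θ = 1 := by
        have h0 := hcos θ hθ
        nlinarith
      rw [hc1]; norm_num
    · right
      norm_num
      exact hs
  have hsl2 : ∀ θ ∈ Icc (-(π / 2)) (π / 2), cexp (θ * I) - -(1 / 2) ∈ slitPlane := by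
    intro θ hθ
    rw [Complex.mem_slitPlane_iff, Complex.sub_re, expI_re]
    left
    have := hcos θ hθ
    norm_num
    linarith
  have hw1 : ∀ θ ∈ Icc (-(π / 2)) (π / 2), cexp (θ * I) - 1 / 2 ≠ 0 := fun θ hθ h0 ↦ by
    have := hsl1 θ hθ; rw [h0] at this; exact Complex.zero_notMem_slitPlane this
  have hw2 : ∀ θ ∈ Icc (-(π / 2)) (π / 2), cexp (θ * I) - -(1 / 2) ≠ 0 := fun θ hθ h0 ↦ by
    have := hsl2 θ hθ; rw [h0] at this; exact Complex.zero_notMem_slitPlane this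
  have h1 := arcLog_eq (by norm_num : (1 / 2 : ℂ) ≠ 0) hsl1
  have h2 : ∫ θ in (-(π / 2))..(π / 2), Real.cos θ *
        ((cexp (θ * I) / (cexp (θ * I) + 1 / 2)).re + Real.log ‖cexp (θ * I) + 1 / 2‖) =
      (Complex.log (I - -(1 / 2)) + Complex.log (-I - -(1 / 2)) -
        I / -(1 / 2) * (Complex.log (I - -(1 / 2)) - Complex.log (-I - -(1 / 2))) - π / -(1 / 2)).re := by
    rw [← arcLog_eq (by norm_num : (-(1 / 2) : ℂ) ≠ 0) hsl2]
    refine intervalIntegral.integral_congr fun θ _ ↦ ?_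
    simp only [sub_neg_eq_add]
  have hi1 := intervalIntegrable_arcLog hw1
  have hi2 : IntervalIntegrable (fun θ : ℝ ↦ Real.cos θ *
        ((cexp (θ * I) / (cexp (θ * I) + 1 / 2)).re + Real.log ‖cexp (θ * I) + 1 / 2‖))
      volume (-(π / 2)) (π / 2) :=
    (intervalIntegrable_arcLog hw2).congr fun θ _ ↦ by simp only [sub_neg_eq_add]
  simp only [sub_neg_eq_add] at h2
  have hsplit : ∫ θ in (-(π / 2))..(π / 2), Real.cos θ *
        ((cexp (θ * I) / (cexp (θ * I) + 1 / 2)).re - (cexp (θ * I) / (cexp (θ * I) - 1 / 2)).re +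
          (Real.log ‖cexp (θ * I) + 1 / 2‖ - Real.log ‖cexp (θ * I) - 1 / 2‖)) =
      (∫ θ in (-(π / 2))..(π / 2), Real.cos θ *
        ((cexp (θ * I) / (cexp (θ * I) + 1 / 2)).re + Real.log ‖cexp (θ * I) + 1 / 2‖)) -
      ∫ θ in (-(π / 2))..(π / 2), Real.cos θ *
        ((cexp (θ * I) / (cexp (θ * I) - 1 / 2)).re + Real.log ‖cexp (θ * I) - 1 / 2‖) := by
    rw [← intervalIntegral.integral_sub hi2 hi1]
    refine intervalIntegral.integral_congr fun θ _ ↦ ?_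
    ring
  rw [hsplit, h1, h2]
  -- the four endpoint logarithms: `w = 1/2 + i`
  set w : ℂ := 1 / 2 + I with hw
  have hwre : 0 < w.re := by simp [hw]
  have hwim : 0 < w.im := by simp [hw]
  have hwim' : (conj w).im < 0 := by simp [hw]
  have e1 : I - (1 / 2 : ℂ) = -conj w := by
    apply Complex.ext <;> simp [hw]
  have e2 : -I - (1 / 2 : ℂ) = -w := by rw [hw]; ring
  have e3 : I + (1 / 2 : ℂ) = w := by rw [hw]; ring
  have e4 : -I + (1 / 2 : ℂ) = conj w := by
    apply Complex.ext <;> simp [hw]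
  have harg : Complex.arg w ≠ π := arg_ne_pi_of_re_pos hwre
  have hargc : Complex.arg (conj w) = -Complex.arg w := by
    rw [Complex.arg_conj, if_neg harg]
  have hL1 : Complex.log (I - (1 / 2 : ℂ)) = Complex.log w - 2 * Complex.arg w * I + π * I := by
    rw [e1, log_neg_of_im_neg hwim', Complex.log_conj _ harg]
    apply Complex.ext
    · simp [Complex.log_re]
    · simp [Complex.log_im]
      ring
  have hL2 : Complex.log (-I - (1 / 2 : ℂ)) = Complex.log w - π * I := by
    rw [e2, log_neg_of_im_pos hwim]
  have hL3 : Complex.log (I + (1 / 2 : ℂ)) = Complex.log w := by rw [e3]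
  have hL4 : Complex.log (-I + (1 / 2 : ℂ)) = Complex.log w - 2 * Complex.arg w * I := by
    rw [e4, Complex.log_conj _ harg]
    apply Complex.ext
    · simp [Complex.log_re]
    · simp [Complex.log_im]
      ring
  rw [hL1, hL2, hL3, hL4]
  have hI3 : I * I = -1 := Complex.I_mul_I
  -- everything is now a polynomial identity in `Log w`, `arg w`, `π`, `I`
  rw [sub_eq_zero]
  congr 1
  linear_combination (4 * (π : ℂ)) * hI3

/-! ### §4 The half-plane Poisson kernel, its radial derivative, and the arc kernel -/

/-- `P(z, t) = (1/π) Re z/|z − it|²` (the half-plane Poisson kernel, `n = 2`). [cite: AxlerBourdonRamey2001, Ch. 7, eq. (7.1)–(7.2) (Poisson kernel of the half-space, n = 2)] -/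
theorem poissonKernel_eq (z : ℂ) (t : ℝ) :
    (π⁻¹ * (1 / (z - t * I)).re) = π⁻¹ * (z.re / Complex.normSq (z - t * I)) := by
  rw [one_div, Complex.inv_re]
  simp

/-- `P(z, t) ≥ 0` for `Re z ≥ 0`. [folklore] -/
private theorem poissonKernel_nonneg {z : ℂ} (hz : 0 ≤ z.re) (t : ℝ) : 0 ≤ (π⁻¹ * (1 / (z - t * I)).re) := by
  rw [poissonKernel_eq]
  exact mul_nonneg (inv_nonneg.2 Real.pi_pos.le) (div_nonneg hz (Complex.normSq_nonneg _))

/-- `|∂_r P(z, t)| ≤ (1/π) |e|/|z − it|²`. [folklore] -/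
private theorem abs_dPoissonKernel_le (e z : ℂ) (t : ℝ) :
    |(π⁻¹ * (-e / (z - t * I) ^ 2).re)| ≤ π⁻¹ * (‖e‖ / Complex.normSq (z - t * I)) := by
  rw [abs_mul, abs_of_pos (inv_pos.2 Real.pi_pos)]
  refine mul_le_mul_of_nonneg_left ?_ (inv_nonneg.2 Real.pi_pos.le)
  refine (Complex.abs_re_le_norm _).trans ?_
  rw [norm_div, norm_neg, norm_pow, Complex.normSq_eq_norm_sq]

/-- `z − it ≠ 0` when `Re z ≠ 0`. [folklore] -/
private theorem sub_mul_I_ne_zero {z : ℂ} (hz : z.re ≠ 0) (t : ℝ) : z - t * I ≠ 0 := by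
  intro h
  have := congrArg Complex.re h
  simp at this
  exact hz this

/-- **Radial derivative of the Poisson kernel**: `d/dr P(re, t) = (π⁻¹ * (-e / ((re) - t * I) ^ 2).re)`
(`re − it ≠ 0`; `P` is real-analytic off the pole). [cite: AxlerBourdonRamey2001, Ch. 7, eq. (7.1)–(7.2) (the Poisson kernel of the half-space is smooth off the boundary point)] -/
theorem hasDerivAt_poissonKernel (e : ℂ) (t : ℝ) {r : ℝ} (h : (r : ℂ) * e - t * I ≠ 0) :
    HasDerivAt (fun r : ℝ ↦ (π⁻¹ * (1 / ((r * e) - t * I)).re)) ((π⁻¹ * (-e / ((r * e) - t * I) ^ 2).re)) r := by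
  have hd : HasDerivAt (fun r : ℝ ↦ (r : ℂ) * e - t * I) e r := by
    have := ((hasDerivAt_id r).ofReal_comp.mul_const e).sub_const ((t : ℂ) * I)
    simpa using this
  have h1 : HasDerivAt (fun r : ℝ ↦ (1 : ℂ) / ((r : ℂ) * e - t * I))
      ((0 * ((r : ℂ) * e - t * I) - 1 * e) / ((r : ℂ) * e - t * I) ^ 2) r :=
    (hasDerivAt_const r (1 : ℂ)).fun_div hd h
  have h2 : HasDerivAt (fun r : ℝ ↦ ((1 : ℂ) / ((r : ℂ) * e - t * I)).re)
      (((0 * ((r : ℂ) * e - t * I) - 1 * e) / ((r : ℂ) * e - t * I) ^ 2)).re r := by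
    have := Complex.reCLM.hasFDerivAt.comp_hasDerivAt r h1
    simpa [Function.comp_def] using this
  have h3 := h2.const_mul π⁻¹
  refine h3.congr_deriv ?_
  congr 2
  ring

/-- Continuity of `t ↦ P(z, t)` for `Re z ≠ 0`. [cite: AxlerBourdonRamey2001, Ch. 7, eq. (7.1)–(7.2) (P_H is continuous off the pole)] -/
theorem continuous_poissonKernel {z : ℂ} (hz : z.re ≠ 0) : Continuous fun t : ℝ ↦ (π⁻¹ * (1 / (z - t * I)).re) := by
  refine continuous_const.mul (Complex.continuous_re.comp ?_)
  exact continuous_const.div (continuous_const.sub (Complex.continuous_ofReal.mul continuous_const))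
    (sub_mul_I_ne_zero hz)

/-- Continuity of `t ↦ ∂_r P(z, t)` for `Re z ≠ 0`. [cite: AxlerBourdonRamey2001, Ch. 7, eq. (7.1)–(7.2) (P_H is smooth off the pole)] -/
theorem continuous_dPoissonKernel (e : ℂ) {z : ℂ} (hz : z.re ≠ 0) :
    Continuous fun t : ℝ ↦ (π⁻¹ * (-e / (z - t * I) ^ 2).re) := by
  refine continuous_const.mul (Complex.continuous_re.comp ?_)
  exact continuous_const.div ((continuous_const.sub (Complex.continuous_ofReal.mul continuous_const)).pow 2)
    (fun t ↦ pow_ne_zero 2 (sub_mul_I_ne_zero hz t))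

/-- `e^{iθ} − it ≠ 0` unless `|t| = 1`. [folklore] -/
private theorem expI_sub_mul_I_ne_zero {t : ℝ} (ht : |t| ≠ 1) (θ : ℝ) : cexp (θ * I) - t * I ≠ 0 := by
  intro h
  have hre := congrArg Complex.re h
  have him := congrArg Complex.im h
  simp only [Complex.sub_re, expI_re, Complex.sub_im, expI_im, Complex.mul_re, Complex.mul_im,
    Complex.ofReal_re, Complex.ofReal_im, Complex.I_re, Complex.I_im, Complex.zero_re,
    Complex.zero_im] at hre him
  have h1 : Real.sin θ = t := by linarith
  have h2 : Real.cos θ = 0 := by linarith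
  have h3 : t ^ 2 = 1 := by
    have h4 := Real.sin_sq_add_cos_sq θ
    rw [h1, h2] at h4
    linarith
  have : |t| = 1 := by
    rw [← sq_eq_sq₀ (abs_nonneg t) zero_le_one, sq_abs, h3, one_pow]
  exact ht this

/-- `e^{iθ} − it` lies off the closed negative real axis for `θ ∈ [−π/2, π/2]` unless `|t| = 1`.
[folklore] -/
private theorem expI_sub_mul_I_mem_slitPlane {t : ℝ} (ht : |t| ≠ 1) {θ : ℝ} (hθ : θ ∈ Icc (-(π / 2)) (π / 2)) :
    cexp (θ * I) - t * I ∈ slitPlane := by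
  rw [Complex.mem_slitPlane_iff]
  have hcos : 0 ≤ Real.cos θ := Real.cos_nonneg_of_mem_Icc hθ
  by_cases hc : Real.cos θ = 0
  · right
    intro him
    simp only [Complex.sub_im, expI_im, Complex.mul_im, Complex.ofReal_re, Complex.ofReal_im,
      Complex.I_re, Complex.I_im, mul_zero, mul_one] at him
    have h1 : Real.sin θ = t := by linarith
    have h3 : t ^ 2 = 1 := by
      have h4 := Real.sin_sq_add_cos_sq θ
      rw [h1, hc] at h4
      linarith
    have : |t| = 1 := by
      rw [← sq_eq_sq₀ (abs_nonneg t) zero_le_one, sq_abs, h3, one_pow]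
    exact ht this
  · left
    simp only [Complex.sub_re, expI_re, Complex.mul_re, Complex.ofReal_re, Complex.ofReal_im,
      Complex.I_re, Complex.I_im, mul_zero, zero_mul, sub_zero]
    exact lt_of_le_of_ne hcos (Ne.symm hc)

/-- `arg(r i) = π/2` for `r > 0`. [folklore] -/
private theorem arg_ofReal_mul_I_of_pos {r : ℝ} (hr : 0 < r) : Complex.arg ((r : ℂ) * I) = π / 2 := by
  rw [Complex.arg_real_mul _ hr, Complex.arg_I]

/-- `arg(r i) = −π/2` for `r < 0`. [folklore] -/
private theorem arg_ofReal_mul_I_of_neg {r : ℝ} (hr : r < 0) : Complex.arg ((r : ℂ) * I) = -(π / 2) := by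
  rw [show (r : ℂ) * I = ((-r : ℝ) : ℂ) * (-I) by push_cast; ring,
    Complex.arg_real_mul _ (by linarith), Complex.arg_neg_I]

/-- The arc kernel vanishes identically at `t = 0` (`∂_r Re(1/z) + Re(1/z) = 0` on `|z| = 1`).
[folklore] -/
private theorem arcKernel_zero (θ : ℝ) :
    (Real.cos θ * ((π⁻¹ * (-cexp (θ * I) / (cexp (θ * I) - ((0 : ℝ) : ℂ) * I) ^ 2).re) +
      (π⁻¹ * (1 / (cexp (θ * I) - ((0 : ℝ) : ℂ) * I)).re))) = 0 := by
  have he : cexp (θ * I) ≠ 0 := expI_ne_zero θ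
  rw [Complex.ofReal_zero, zero_mul, sub_zero]
  rw [show -cexp (θ * I) / cexp (θ * I) ^ 2 = -(1 / cexp (θ * I)) by field_simp]
  rw [Complex.neg_re]
  ring

/-- **The arc kernel integrates to `1_{|t|>1}/t²`**:
`∫_{-π/2}^{π/2} cos θ (∂_r P + P)(e^{iθ}, t) dθ = 1/t²` for `|t| > 1` and `= 0` for `|t| < 1`
(by the master identity this is `(1/π) Re ∫ e^{-iθ} dθ/(e^{iθ} − it) = (1 − Im Δ_t/π)/t²` with
`Δ_t = Log((1−t)i) − Log(−(1+t)i)`, whose imaginary part is `0` for `|t| > 1` and `π` for `|t| < 1`).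
[folklore] -/
private theorem integral_arcKernel {t : ℝ} (ht : |t| ≠ 1) :
    ∫ θ in (-(π / 2))..(π / 2), (Real.cos θ * ((π⁻¹ * (-cexp (θ * I) / (cexp (θ * I) - t * I) ^ 2).re) + (π⁻¹ * (1 / (cexp (θ * I) - t * I)).re))) = if 1 < |t| then 1 / t ^ 2 else 0 := by
  have hpi : -(π / 2) ≤ π / 2 := by linarith [Real.pi_pos]
  by_cases ht0 : t = 0
  · subst ht0
    simp only [arcKernel_zero, intervalIntegral.integral_zero, abs_zero]
    norm_num
  have hne : ∀ θ : ℝ, cexp (θ * I) - t * I ≠ 0 := expI_sub_mul_I_ne_zero ht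
  have hec : Continuous fun θ : ℝ ↦ cexp (θ * I) :=
    Complex.continuous_exp.comp (Complex.continuous_ofReal.mul continuous_const)
  -- the master identity for `G(θ) = (1/π)/(e^{iθ} − it)`
  set G : ℝ → ℂ := fun θ ↦ (π : ℂ)⁻¹ * (1 / (cexp (θ * I) - t * I)) with hGdef
  set G' : ℝ → ℂ := fun θ ↦ (π : ℂ)⁻¹ * (-(I * cexp (θ * I)) / (cexp (θ * I) - t * I) ^ 2)
    with hG'def
  have hd : ∀ θ : ℝ, HasDerivAt G (G' θ) θ := by
    intro θ
    have h1 := (hasDerivAt_const θ (1 : ℂ)).fun_div ((hasDerivAt_expI θ).sub_const ((t : ℂ) * I))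
      (hne θ)
    have h2 := h1.const_mul (π : ℂ)⁻¹
    simp only [hGdef, hG'def]
    refine h2.congr_deriv ?_
    congr 1
    ring
  have hGc : Continuous G := continuous_const.mul (continuous_const.div (hec.sub continuous_const) hne)
  have hG'c : Continuous G' :=
    continuous_const.mul (((continuous_const.mul hec).neg).div ((hec.sub continuous_const).pow 2)
      fun θ ↦ pow_ne_zero 2 (hne θ))
  have hMI := arc_master_identity hpi hGc.continuousOn (fun θ _ ↦ hd θ)
    (hG'c.intervalIntegrable _ _)
  rw [Real.cos_pi_div_two, Real.cos_neg, Real.cos_pi_div_two, zero_mul, zero_mul, sub_zero,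
    add_zero] at hMI
  have hπ : ((π : ℂ)⁻¹) = ((π⁻¹ : ℝ) : ℂ) := by push_cast; ring
  have hlhs : ∫ θ in (-(π / 2))..(π / 2), Real.cos θ * ((G' θ).im + (G θ).re) =
      ∫ θ in (-(π / 2))..(π / 2), (Real.cos θ * ((π⁻¹ * (-cexp (θ * I) / (cexp (θ * I) - t * I) ^ 2).re) + (π⁻¹ * (1 / (cexp (θ * I) - t * I)).re))) := by
    refine intervalIntegral.integral_congr fun θ _ ↦ ?_
    simp only [hGdef, hG'def, hπ, Complex.re_ofReal_mul,
      Complex.im_ofReal_mul]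
    congr 2
    rw [show -(I * cexp (θ * I)) / (cexp (θ * I) - t * I) ^ 2 =
      I * (-cexp (θ * I) / (cexp (θ * I) - t * I) ^ 2) by ring, Complex.I_mul_im]
  rw [← hlhs, hMI]
  -- pull out the constant `1/π` and take the real part outside
  have hint : IntervalIntegrable (fun θ ↦ cexp (-(θ * I)) * G θ) volume (-(π / 2)) (π / 2) :=
    ((Complex.continuous_exp.comp ((Complex.continuous_ofReal.mul continuous_const).neg)).mul
      hGc).intervalIntegrable _ _
  have hrhs : ∫ θ in (-(π / 2))..(π / 2), (cexp (-(θ * I)) * G θ).re =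
      (∫ θ in (-(π / 2))..(π / 2), cexp (-(θ * I)) * G θ).re := by
    have := intervalIntegral_re hint
    simpa only [RCLike.re_to_complex] using this
  rw [hrhs]
  have hfac : ∫ θ in (-(π / 2))..(π / 2), cexp (-(θ * I)) * G θ =
      (π : ℂ)⁻¹ * ∫ θ in (-(π / 2))..(π / 2), cexp (-(θ * I)) / (cexp (θ * I) - t * I) := by
    rw [← intervalIntegral.integral_const_mul]
    refine intervalIntegral.integral_congr fun θ _ ↦ ?_
    simp only [hGdef]
    ring
  rw [hfac]
  -- the antiderivative `Ψ(θ) = −e^{-iθ}/t + θ/t² + i Log(e^{iθ} − it)/t²`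
  have htC : (t : ℂ) ≠ 0 := Complex.ofReal_ne_zero.2 ht0
  have hsl : ∀ θ ∈ Icc (-(π / 2)) (π / 2), cexp (θ * I) - t * I ∈ slitPlane :=
    fun θ hθ ↦ expI_sub_mul_I_mem_slitPlane ht hθ
  set Ψ : ℝ → ℂ := fun θ ↦ -cexp (-(θ * I)) / t + θ / (t : ℂ) ^ 2 +
    I * Complex.log (cexp (θ * I) - t * I) / (t : ℂ) ^ 2 with hΨ
  have hΨc : ContinuousOn Ψ (Icc (-(π / 2)) (π / 2)) := by
    refine ContinuousOn.add (Continuous.continuousOn ?_) ?_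
    · exact ((Complex.continuous_exp.comp
        ((Complex.continuous_ofReal.mul continuous_const).neg)).neg.div_const _).add
        (Complex.continuous_ofReal.div_const _)
    · refine ContinuousOn.div_const (continuousOn_const.mul ?_) _
      have := continuousOn_log_expI_sub (c := (t : ℂ) * I) hsl
      exact this
  have hΨd : ∀ θ ∈ Ioo (-(π / 2)) (π / 2),
      HasDerivAt Ψ (cexp (-(θ * I)) / (cexp (θ * I) - t * I)) θ := by
    intro θ hθ
    have h1 : HasDerivAt (fun θ : ℝ ↦ -cexp (-(θ * I)) / t) (-(-I * cexp (-(θ * I))) / t) θ :=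
      (hasDerivAt_expNegI θ).neg.div_const _
    have h2 : HasDerivAt (fun θ : ℝ ↦ (θ : ℂ) / (t : ℂ) ^ 2) (1 / (t : ℂ) ^ 2) θ :=
      (hasDerivAt_id θ).ofReal_comp.div_const _ |>.congr_deriv (by simp)
    have h3 : HasDerivAt (fun θ : ℝ ↦ I * Complex.log (cexp (θ * I) - t * I) / (t : ℂ) ^ 2)
        (I * (I * cexp (θ * I) / (cexp (θ * I) - t * I)) / (t : ℂ) ^ 2) θ :=
      ((hasDerivAt_log_expI_sub (hsl θ (Ioo_subset_Icc_self hθ))).const_mul I).div_const _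
    have h := (h1.add h2).add h3
    refine h.congr_deriv ?_
    have hII : I * I = -1 := Complex.I_mul_I
    have hw := hne θ
    have he : cexp (θ * I) ≠ 0 := expI_ne_zero θ
    have k1 : I * (I * cexp (θ * I) / (cexp (θ * I) - t * I)) = -(cexp (θ * I) / (cexp (θ * I) - t * I)) := by
      rw [show I * (I * cexp (θ * I) / (cexp (θ * I) - t * I)) =
        (I * I) * (cexp (θ * I) / (cexp (θ * I) - t * I)) by ring, hII]
      ring
    rw [k1, Complex.exp_neg]
    generalize cexp (θ * I) = E at hw he ⊢
    rw [mul_comm] at hw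
    field_simp
    linear_combination (-(t : ℂ) ^ 2) * hII
  have hint2 : IntervalIntegrable (fun θ ↦ cexp (-(θ * I)) / (cexp (θ * I) - t * I)) volume
      (-(π / 2)) (π / 2) :=
    ((Complex.continuous_exp.comp ((Complex.continuous_ofReal.mul continuous_const).neg)).div
      (hec.sub continuous_const) hne).intervalIntegrable _ _
  rw [intervalIntegral.integral_eq_sub_of_hasDerivAt_of_le hpi hΨc hΨd hint2]
  set Δ : ℂ := Complex.log (I - t * I) - Complex.log (-I - t * I) with hΔ
  have hV : Ψ (π / 2) - Ψ (-(π / 2)) = 2 * I / t + (π + I * Δ) / (t : ℂ) ^ 2 := by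
    simp only [hΨ]
    rw [expNegI_pi_div_two, expI_pi_div_two, expNegI_neg_pi_div_two, expI_neg_pi_div_two, hΔ]
    push_cast
    field_simp
    ring
  rw [hV]
  have hre : ((π : ℂ)⁻¹ * (2 * I / t + (π + I * Δ) / (t : ℂ) ^ 2)).re = (π - Δ.im) / (π * t ^ 2) := by
    rw [show ((π : ℂ)⁻¹) = ((π⁻¹ : ℝ) : ℂ) by push_cast; ring, Complex.re_ofReal_mul,
      show ((t : ℂ) ^ 2) = ((t ^ 2 : ℝ) : ℂ) by push_cast; ring, Complex.add_re,
      Complex.div_ofReal_re, Complex.div_ofReal_re, Complex.add_re, Complex.I_mul_re,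
      Complex.ofReal_re]
    simp
    field_simp
    ring
  rw [hre]
  -- the imaginary part of `Δ = Log((1−t)i) − Log(−(1+t)i)`
  have hΔim : Δ.im = Complex.arg (((1 - t : ℝ) : ℂ) * I) - Complex.arg (((-(1 + t) : ℝ) : ℂ) * I) := by
    rw [hΔ, Complex.sub_im, Complex.log_im, Complex.log_im]
    congr 2
    · push_cast; ring
    · push_cast; ring
  by_cases h : 1 < |t|
  · rw [if_pos h]
    have him : Δ.im = 0 := by
      rw [hΔim]
      rcases lt_or_gt_of_ne (show t ≠ 0 from ht0) with hneg | hpos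
      · rw [abs_of_neg hneg] at h
        rw [arg_ofReal_mul_I_of_pos (by linarith), arg_ofReal_mul_I_of_pos (by linarith)]
        ring
      · rw [abs_of_pos hpos] at h
        rw [arg_ofReal_mul_I_of_neg (by linarith), arg_ofReal_mul_I_of_neg (by linarith)]
        ring
    rw [him, sub_zero]
    field_simp
  · rw [if_neg h]
    have h' : |t| < 1 := lt_of_le_of_ne (not_lt.1 h) ht
    rw [abs_lt] at h'
    have him : Δ.im = π := by
      rw [hΔim, arg_ofReal_mul_I_of_pos (by linarith), arg_ofReal_mul_I_of_neg (by linarith)]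
      ring
    rw [him, sub_self, zero_div]

/-! ### §5 Poisson integrals: differentiation along rays and the arc functional

For `g : ℝ → ℝ` with `g(t)/(1+t²) ∈ L¹`, the Poisson integral `H(z) = ∫ P(z,t) g(t) dt` is
differentiable along rays through the right half-plane (differentiation under the integral sign),
and, when moreover `g` is bounded near `[−2, 2]`, Fubini and `integral_arcKernel` give
`∫_{-π/2}^{π/2} cos θ (∂_r H + H)(e^{iθ}) dθ = ∫_{|t|>1} g(t) dt/t²`. -/

/-- `∫_ℝ c dt/(c² + (t − s)²) = π` for `c > 0` (the Poisson kernel has mass one), with integrability.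
[folklore] -/
private theorem integral_poisson_mass {c : ℝ} (hc : 0 < c) (s : ℝ) :
    Integrable (fun t : ℝ ↦ c / (c ^ 2 + (t - s) ^ 2)) ∧ ∫ t : ℝ, c / (c ^ 2 + (t - s) ^ 2) = π := by
  set h : ℝ → ℝ := fun u ↦ (1 + u ^ 2)⁻¹ with hh
  have hint : Integrable h := integrable_inv_one_add_sq
  have hval : ∫ u, h u = π := integral_univ_inv_one_add_sq
  have hform : ∀ t : ℝ, c / (c ^ 2 + (t - s) ^ 2) = c⁻¹ * h (c⁻¹ * (t - s)) := by
    intro t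
    simp only [hh]
    have hc0 : c ≠ 0 := hc.ne'
    field_simp
  have hint2 : Integrable fun t : ℝ ↦ c⁻¹ * h (c⁻¹ * (t - s)) := by
    have h1 : Integrable fun u : ℝ ↦ h (c⁻¹ * u) := hint.comp_mul_left' (inv_ne_zero hc.ne')
    have h2 : Integrable fun t : ℝ ↦ h (c⁻¹ * (t - s)) := h1.comp_sub_right s
    exact h2.const_mul _
  refine ⟨hint2.congr (ae_of_all _ fun t ↦ (hform t).symm), ?_⟩
  rw [integral_congr_ae (ae_of_all _ hform), MeasureTheory.integral_const_mul]
  have h3 : ∫ t : ℝ, h (c⁻¹ * (t - s)) = ∫ t : ℝ, h (c⁻¹ * t) := by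
    have := integral_sub_right_eq_self (μ := (volume : Measure ℝ)) (fun t : ℝ ↦ h (c⁻¹ * t)) s
    exact this
  rw [h3, MeasureTheory.Measure.integral_comp_inv_mul_left, hval, smul_eq_mul, abs_of_pos hc]
  field_simp

/-- `|e^{iθ} − it|² = cos²θ + (t − sin θ)²`. [folklore] -/
private theorem normSq_expI_sub (θ t : ℝ) :
    Complex.normSq (cexp (θ * I) - t * I) = Real.cos θ ^ 2 + (t - Real.sin θ) ^ 2 := by
  rw [Complex.normSq_apply]
  simp only [Complex.sub_re, Complex.sub_im, expI_re, expI_im, Complex.mul_re, Complex.mul_im,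
    Complex.ofReal_re, Complex.ofReal_im, Complex.I_re, Complex.I_im]
  ring

/-- For `|t| ≥ 2`: `|e^{iθ} − it|² ≥ (1 + t²)/8`. [folklore] -/
private theorem normSq_expI_sub_ge {t : ℝ} (ht : 2 ≤ |t|) (θ : ℝ) :
    (1 + t ^ 2) / 8 ≤ Complex.normSq (cexp (θ * I) - t * I) := by
  rw [normSq_expI_sub]
  have hs := Real.abs_sin_le_one θ
  have h1 : (|t| - 1) ^ 2 ≤ (t - Real.sin θ) ^ 2 := by
    have h2 : |t| - 1 ≤ |t - Real.sin θ| := by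
      have := abs_sub_abs_le_abs_sub t (Real.sin θ)
      linarith
    have h3 : 0 ≤ |t| - 1 := by linarith
    calc (|t| - 1) ^ 2 ≤ |t - Real.sin θ| ^ 2 := pow_le_pow_left₀ h3 h2 2
      _ = (t - Real.sin θ) ^ 2 := sq_abs _
  have h4 : t ^ 2 = |t| ^ 2 := (sq_abs t).symm
  nlinarith [sq_nonneg (Real.cos θ), sq_nonneg (|t| - 2)]

/-- Along a ray `r ↦ re` (`Re e > 0`, `1/2 < r < 3/2`): `1 + t² ≤ C |re − it|²` with
`C = max 2 (4(1 + 5 (Im e)²)/(Re e)²)`. [folklore] -/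
private theorem one_add_sq_le_mul_normSq {e : ℂ} (he : 0 < e.re) {r : ℝ} (hr : r ∈ Ioo (1 / 2 : ℝ) (3 / 2))
    (t : ℝ) :
    1 + t ^ 2 ≤ max 2 (4 * (1 + 5 * e.im ^ 2) / e.re ^ 2) * Complex.normSq ((r : ℂ) * e - t * I) := by
  set C : ℝ := max 2 (4 * (1 + 5 * e.im ^ 2) / e.re ^ 2) with hC
  have hC2 : 2 ≤ C := le_max_left _ _
  have hCa : 4 * (1 + 5 * e.im ^ 2) / e.re ^ 2 ≤ C := le_max_right _ _
  have hns : Complex.normSq ((r : ℂ) * e - t * I) = (r * e.re) ^ 2 + (r * e.im - t) ^ 2 := by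
    rw [Complex.normSq_apply]
    simp only [Complex.sub_re, Complex.sub_im, Complex.mul_re, Complex.mul_im, Complex.ofReal_re,
      Complex.ofReal_im, Complex.I_re, Complex.I_im]
    ring
  rw [hns, mul_add]
  have hr1 : 1 / 2 < r := hr.1
  have hr2 : r < 3 / 2 := hr.2
  have ha : 0 < e.re ^ 2 := pow_pos he 2
  have k1 : 1 + 5 * e.im ^ 2 ≤ 4 * (1 + 5 * e.im ^ 2) / e.re ^ 2 * (r * e.re) ^ 2 := by
    rw [show 4 * (1 + 5 * e.im ^ 2) / e.re ^ 2 * (r * e.re) ^ 2 = 4 * (1 + 5 * e.im ^ 2) * r ^ 2 by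
      field_simp]
    nlinarith [mul_nonneg (show (0 : ℝ) ≤ 4 * r ^ 2 - 1 by nlinarith)
      (show (0 : ℝ) ≤ 1 + 5 * e.im ^ 2 by positivity)]
  have k2 : 4 * (1 + 5 * e.im ^ 2) / e.re ^ 2 * (r * e.re) ^ 2 ≤ C * (r * e.re) ^ 2 :=
    mul_le_mul_of_nonneg_right hCa (sq_nonneg _)
  have k3 : 2 * (r * e.im - t) ^ 2 ≤ C * (r * e.im - t) ^ 2 :=
    mul_le_mul_of_nonneg_right hC2 (sq_nonneg _)
  have k4 : t ^ 2 ≤ 2 * (r * e.im - t) ^ 2 + 5 * e.im ^ 2 := by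
    have k5 : r ^ 2 ≤ 9 / 4 := by nlinarith
    nlinarith [sq_nonneg (r * e.im - (t - r * e.im)),
      mul_le_mul_of_nonneg_right k5 (sq_nonneg e.im)]
  linarith

/-- **Differentiation of the Poisson integral along a ray.** For `g` with `g/(1+t²) ∈ L¹` and
`Re e > 0`: `t ↦ P(e,t)g(t)` and `t ↦ ∂_r P(e,t) g(t)` are integrable and
`r ↦ ∫ P(re, t) g(t) dt` has derivative `∫ ∂_r P(e, t) g(t) dt` at `r = 1` (dominated differentiation
under the integral sign on `1/2 < r < 3/2`). [cite: AxlerBourdonRamey2001, Ch. 7, Thm. 7.3 and its proof (the Poisson integral of the half-space is harmonic: differentiation under the integral sign)] -/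
theorem hasDerivAt_poissonIntegral {g : ℝ → ℝ} (hgm : AEStronglyMeasurable g volume)
    (hg : Integrable (fun t ↦ g t / (1 + t ^ 2))) {e : ℂ} (he : 0 < e.re) :
    Integrable (fun t : ℝ ↦ (π⁻¹ * (1 / (e - t * I)).re) * g t) ∧
      Integrable (fun t : ℝ ↦ (π⁻¹ * (-e / (e - t * I) ^ 2).re) * g t) ∧
        HasDerivAt (fun r : ℝ ↦ ∫ t : ℝ, (π⁻¹ * (1 / ((r * e) - t * I)).re) * g t)
          (∫ t : ℝ, (π⁻¹ * (-e / (e - t * I) ^ 2).re) * g t) 1 := by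
  set C : ℝ := max 2 (4 * (1 + 5 * e.im ^ 2) / e.re ^ 2) with hC
  have hC0 : 0 ≤ C := le_trans (by norm_num) (le_max_left _ _)
  have hs : Ioo (1 / 2 : ℝ) (3 / 2) ∈ 𝓝 (1 : ℝ) := Ioo_mem_nhds (by norm_num) (by norm_num)
  have hre : ∀ r ∈ Ioo (1 / 2 : ℝ) (3 / 2), 0 < ((r : ℂ) * e).re := by
    intro r hr
    rw [Complex.re_ofReal_mul]
    exact mul_pos (by linarith [hr.1]) he
  have hne : ∀ r ∈ Ioo (1 / 2 : ℝ) (3 / 2), ∀ t : ℝ, (r : ℂ) * e - t * I ≠ 0 :=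
    fun r hr t ↦ sub_mul_I_ne_zero (hre r hr).ne' t
  -- the key bound `1/normSq ≤ C/(1+t²)` along the ray
  have hinv : ∀ r ∈ Ioo (1 / 2 : ℝ) (3 / 2), ∀ t : ℝ,
      1 / Complex.normSq ((r : ℂ) * e - t * I) ≤ C / (1 + t ^ 2) := by
    intro r hr t
    have hpos : 0 < Complex.normSq ((r : ℂ) * e - t * I) := Complex.normSq_pos.2 (hne r hr t)
    rw [div_le_div_iff₀ hpos (by positivity), one_mul]
    exact one_add_sq_le_mul_normSq he hr t
  set F : ℝ → ℝ → ℝ := fun r t ↦ (π⁻¹ * (1 / ((r * e) - t * I)).re) * g t with hF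
  set F' : ℝ → ℝ → ℝ := fun r t ↦ (π⁻¹ * (-e / ((r * e) - t * I) ^ 2).re) * g t with hF'
  set bound : ℝ → ℝ := fun t ↦ π⁻¹ * (‖e‖ * (C * |g t / (1 + t ^ 2)|)) with hbound
  have hF_meas : ∀ᶠ r in 𝓝 (1 : ℝ), AEStronglyMeasurable (F r) volume := by
    refine Filter.eventually_of_mem hs fun r hr ↦ ?_
    exact (continuous_poissonKernel (hre r hr).ne').aestronglyMeasurable.mul hgm
  have habs : ∀ t : ℝ, |g t / (1 + t ^ 2)| = |g t| / (1 + t ^ 2) := fun t ↦ by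
    rw [abs_div, abs_of_pos (by positivity : (0 : ℝ) < 1 + t ^ 2)]
  -- integrability at `r = 1`
  have h1mem : (1 : ℝ) ∈ Ioo (1 / 2 : ℝ) (3 / 2) := ⟨by norm_num, by norm_num⟩
  have hPint : Integrable (fun t : ℝ ↦ (π⁻¹ * (1 / (e - t * I)).re) * g t) := by
    have hb : Integrable fun t ↦ π⁻¹ * (e.re * (C * |g t / (1 + t ^ 2)|)) :=
      ((hg.abs.const_mul C).const_mul e.re).const_mul π⁻¹
    refine hb.mono' ((continuous_poissonKernel he.ne').aestronglyMeasurable.mul hgm)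
      (ae_of_all _ fun t ↦ ?_)
    rw [Real.norm_eq_abs, abs_mul, poissonKernel_eq, abs_mul, abs_of_pos (inv_pos.2 Real.pi_pos),
      abs_div, abs_of_pos he, abs_of_nonneg (Complex.normSq_nonneg _), habs]
    have h1 := hinv 1 h1mem t
    simp only [Complex.ofReal_one, one_mul] at h1
    have : e.re / Complex.normSq (e - t * I) * |g t| ≤ e.re * (C * (|g t| / (1 + t ^ 2))) := by
      rw [div_eq_mul_one_div, mul_assoc]
      refine mul_le_mul_of_nonneg_left ?_ he.le
      calc 1 / Complex.normSq (e - t * I) * |g t| ≤ C / (1 + t ^ 2) * |g t| :=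
            mul_le_mul_of_nonneg_right h1 (abs_nonneg _)
        _ = C * (|g t| / (1 + t ^ 2)) := by ring
    rw [mul_assoc]
    exact mul_le_mul_of_nonneg_left this (inv_nonneg.2 Real.pi_pos.le)
  have hF_int : Integrable (F 1) := by
    simp only [hF, Complex.ofReal_one, one_mul]; exact hPint
  have hF'_meas : AEStronglyMeasurable (F' 1) volume := by
    simp only [hF', Complex.ofReal_one, one_mul]
    exact (continuous_dPoissonKernel e he.ne').aestronglyMeasurable.mul hgm
  have h_bound : ∀ᵐ t ∂volume, ∀ r ∈ Ioo (1 / 2 : ℝ) (3 / 2), ‖F' r t‖ ≤ bound t := by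
    refine ae_of_all _ fun t r hr ↦ ?_
    simp only [hF', hbound]
    rw [Real.norm_eq_abs, abs_mul, habs]
    have h1 := abs_dPoissonKernel_le e ((r : ℂ) * e) t
    have h2 := hinv r hr t
    calc |(π⁻¹ * (-e / (((r : ℂ) * e) - t * I) ^ 2).re)| * |g t|
        ≤ π⁻¹ * (‖e‖ / Complex.normSq ((r : ℂ) * e - t * I)) * |g t| :=
          mul_le_mul_of_nonneg_right h1 (abs_nonneg _)
      _ = π⁻¹ * (‖e‖ * (1 / Complex.normSq ((r : ℂ) * e - t * I) * |g t|)) := by ring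
      _ ≤ π⁻¹ * (‖e‖ * (C / (1 + t ^ 2) * |g t|)) := by
          gcongr
      _ = π⁻¹ * (‖e‖ * (C * (|g t| / (1 + t ^ 2)))) := by ring
  have hbound_int : Integrable bound := ((hg.abs.const_mul C).const_mul ‖e‖).const_mul π⁻¹
  have h_diff : ∀ᵐ t ∂volume, ∀ r ∈ Ioo (1 / 2 : ℝ) (3 / 2), HasDerivAt (F · t) (F' r t) r := by
    refine ae_of_all _ fun t r hr ↦ ?_
    simp only [hF, hF']
    exact (hasDerivAt_poissonKernel e t (hne r hr t)).mul_const (g t)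
  have hmain := hasDerivAt_integral_of_dominated_loc_of_deriv_le hs hF_meas hF_int hF'_meas h_bound
    hbound_int h_diff
  simp only [hF, hF', Complex.ofReal_one, one_mul] at hmain
  exact ⟨hPint, hmain.1, hmain.2⟩

/-- Measurability of the arc kernel as a function of `(θ, t)`. [folklore] -/
private theorem measurable_arcKernel : Measurable fun p : ℝ × ℝ ↦ (Real.cos p.1 * ((π⁻¹ * (-cexp (p.1 * I) / (cexp (p.1 * I) - p.2 * I) ^ 2).re) + (π⁻¹ * (1 / (cexp (p.1 * I) - p.2 * I)).re))) := by
  fun_prop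

/-- Pointwise bound for the arc kernel: `|κ(θ, t)| ≤ (2/π) cos θ/|e^{iθ} − it|²` for `cos θ ≥ 0`.
[folklore] -/
private theorem abs_arcKernel_le {θ : ℝ} (hθ : 0 ≤ Real.cos θ) (t : ℝ) :
    |(Real.cos θ * ((π⁻¹ * (-cexp (θ * I) / (cexp (θ * I) - t * I) ^ 2).re) + (π⁻¹ * (1 / (cexp (θ * I) - t * I)).re)))| ≤ 2 * π⁻¹ * (Real.cos θ / Complex.normSq (cexp (θ * I) - t * I)) := by
  rw [abs_mul, abs_of_nonneg hθ]
  have h1 := abs_dPoissonKernel_le (cexp (θ * I)) (cexp (θ * I)) t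
  rw [norm_expI] at h1
  have h2 : |(π⁻¹ * (1 / ((cexp (θ * I)) - t * I)).re)| ≤ π⁻¹ * (1 / Complex.normSq (cexp (θ * I) - t * I)) := by
    rw [abs_of_nonneg (poissonKernel_nonneg (by rw [expI_re]; exact hθ) t), poissonKernel_eq, expI_re]
    refine mul_le_mul_of_nonneg_left ?_ (inv_nonneg.2 Real.pi_pos.le)
    exact div_le_div_of_nonneg_right (Real.cos_le_one θ) (Complex.normSq_nonneg _)
  calc Real.cos θ * |(π⁻¹ * (-(cexp (θ * I)) / ((cexp (θ * I)) - t * I) ^ 2).re) + (π⁻¹ * (1 / ((cexp (θ * I)) - t * I)).re)|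
      ≤ Real.cos θ * (π⁻¹ * (1 / Complex.normSq (cexp (θ * I) - t * I)) +
          π⁻¹ * (1 / Complex.normSq (cexp (θ * I) - t * I))) :=
        mul_le_mul_of_nonneg_left ((abs_add_le _ _).trans (add_le_add h1 h2)) hθ
    _ = 2 * π⁻¹ * (Real.cos θ / Complex.normSq (cexp (θ * I) - t * I)) := by ring

/-- **The arc functional of a Poisson integral.** For `g : ℝ → ℝ` with `g/(1+t²) ∈ L¹` and
`|g| ≤ M` on `[−2, 2]`: writing `H(z) = ∫ P(z,t) g(t) dt` and `H'(θ) = ∫ ∂_r P(e^{iθ},t) g(t) dt` for its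
radial derivative (`hasDerivAt_poissonIntegral`), the function `θ ↦ cos θ (H'(θ) + H(e^{iθ}))` is
integrable on `(−π/2, π/2)` and `∫_{-π/2}^{π/2} cos θ (H'(θ) + H(e^{iθ})) dθ = ∫_{|t|>1} g(t) dt/t²`
(Fubini, then `integral_arcKernel`). This is the inner-arc term of Carleman's theorem for the harmonic
function `H`, obtained without Green's formula. [cite: Titchmarsh1939, §3.71 (Carleman's theorem: the terms on |z| = ρ and on the imaginary axis, R = ∞); Wang1946, Lemma (region bounded by the unit semicircle K and the broken line C)] -/
theorem arc_poissonIntegral_eq {g : ℝ → ℝ} (hgm : AEStronglyMeasurable g volume)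
    (hg : Integrable (fun t ↦ g t / (1 + t ^ 2))) {M : ℝ} (hM : ∀ t, |t| ≤ 2 → |g t| ≤ M) :
    IntervalIntegrable (fun θ : ℝ ↦ Real.cos θ *
        ((∫ t : ℝ, (π⁻¹ * (-(cexp (θ * I)) / ((cexp (θ * I)) - t * I) ^ 2).re) * g t) +
          ∫ t : ℝ, (π⁻¹ * (1 / ((cexp (θ * I)) - t * I)).re) * g t)) volume (-(π / 2)) (π / 2) ∧
      ∫ θ in (-(π / 2))..(π / 2), Real.cos θ *
          ((∫ t : ℝ, (π⁻¹ * (-(cexp (θ * I)) / ((cexp (θ * I)) - t * I) ^ 2).re) * g t) +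
            ∫ t : ℝ, (π⁻¹ * (1 / ((cexp (θ * I)) - t * I)).re) * g t) =
        ∫ t in {t : ℝ | 1 < |t|}, g t / t ^ 2 := by
  have hpi : -(π / 2) ≤ π / 2 := by linarith [Real.pi_pos]
  have hM0 : 0 ≤ M := le_trans (abs_nonneg _) (hM 0 (by norm_num))
  set S : Set ℝ := Ioo (-(π / 2)) (π / 2) with hS
  have hSm : MeasurableSet S := measurableSet_Ioo
  set μ : Measure ℝ := volume.restrict S with hμ
  haveI : IsFiniteMeasure μ := by rw [hμ, hS]; infer_instance
  have hcos : ∀ θ ∈ S, 0 < Real.cos θ := fun θ hθ ↦ Real.cos_pos_of_mem_Ioo hθ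
  -- the integrand on the product and its dominating function
  set f : ℝ × ℝ → ℝ := fun p ↦ (Real.cos p.1 * ((π⁻¹ * (-cexp (p.1 * I) / (cexp (p.1 * I) - p.2 * I) ^ 2).re) + (π⁻¹ * (1 / (cexp (p.1 * I) - p.2 * I)).re))) * g p.2 with hf
  set D : ℝ × ℝ → ℝ := fun p ↦ 2 * π⁻¹ * M * (Real.cos p.1 / (Real.cos p.1 ^ 2 + (p.2 - Real.sin p.1) ^ 2)) +
    16 * π⁻¹ * (1 * |g p.2 / (1 + p.2 ^ 2)|) with hD
  have hfm : AEStronglyMeasurable f (μ.prod volume) :=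
    (measurable_arcKernel.aestronglyMeasurable).mul (hgm.comp_snd)
  have habs : ∀ t : ℝ, |g t / (1 + t ^ 2)| = |g t| / (1 + t ^ 2) := fun t ↦ by
    rw [abs_div, abs_of_pos (by positivity : (0 : ℝ) < 1 + t ^ 2)]
  have hbound : ∀ p : ℝ × ℝ, p.1 ∈ S → ‖f p‖ ≤ D p := by
    rintro ⟨θ, t⟩ hθ
    simp only [hf, hD]
    have hc := hcos θ hθ
    rw [Real.norm_eq_abs, abs_mul, habs]
    have hk := abs_arcKernel_le hc.le t
    rw [normSq_expI_sub] at hk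
    have hq : 0 < Real.cos θ ^ 2 + (t - Real.sin θ) ^ 2 := by positivity
    have hA : 0 ≤ 2 * π⁻¹ * M * (Real.cos θ / (Real.cos θ ^ 2 + (t - Real.sin θ) ^ 2)) := by
      have : 0 ≤ Real.cos θ / (Real.cos θ ^ 2 + (t - Real.sin θ) ^ 2) := div_nonneg hc.le hq.le
      positivity
    have hB : 0 ≤ 16 * π⁻¹ * (1 * (|g t| / (1 + t ^ 2))) := by positivity
    by_cases ht : |t| ≤ 2
    · calc |(Real.cos θ * ((π⁻¹ * (-cexp (θ * I) / (cexp (θ * I) - t * I) ^ 2).re) + (π⁻¹ * (1 / (cexp (θ * I) - t * I)).re)))| * |g t|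
          ≤ 2 * π⁻¹ * (Real.cos θ / (Real.cos θ ^ 2 + (t - Real.sin θ) ^ 2)) * M :=
            mul_le_mul hk (hM t ht) (abs_nonneg _) (by positivity)
        _ = 2 * π⁻¹ * M * (Real.cos θ / (Real.cos θ ^ 2 + (t - Real.sin θ) ^ 2)) := by ring
        _ ≤ _ := le_add_of_nonneg_right hB
    · have ht' : 2 ≤ |t| := (not_le.1 ht).le
      have hns := normSq_expI_sub_ge ht' θ
      rw [normSq_expI_sub] at hns
      have hk' : |(Real.cos θ * ((π⁻¹ * (-cexp (θ * I) / (cexp (θ * I) - t * I) ^ 2).re) + (π⁻¹ * (1 / (cexp (θ * I) - t * I)).re)))| ≤ 16 * π⁻¹ * (1 / (1 + t ^ 2)) := by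
        refine hk.trans ?_
        have hc1 := Real.cos_le_one θ
        have : Real.cos θ / (Real.cos θ ^ 2 + (t - Real.sin θ) ^ 2) ≤ 1 / ((1 + t ^ 2) / 8) :=
          div_le_div₀ zero_le_one hc1 (by positivity) hns
        calc 2 * π⁻¹ * (Real.cos θ / (Real.cos θ ^ 2 + (t - Real.sin θ) ^ 2))
            ≤ 2 * π⁻¹ * (1 / ((1 + t ^ 2) / 8)) :=
              mul_le_mul_of_nonneg_left this (by positivity)
          _ = 16 * π⁻¹ * (1 / (1 + t ^ 2)) := by field_simp; ring
      calc |(Real.cos θ * ((π⁻¹ * (-cexp (θ * I) / (cexp (θ * I) - t * I) ^ 2).re) + (π⁻¹ * (1 / (cexp (θ * I) - t * I)).re)))| * |g t| ≤ 16 * π⁻¹ * (1 / (1 + t ^ 2)) * |g t| :=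
            mul_le_mul_of_nonneg_right hk' (abs_nonneg _)
        _ = 16 * π⁻¹ * (1 * (|g t| / (1 + t ^ 2))) := by ring
        _ ≤ _ := le_add_of_nonneg_left hA
  -- `D` is integrable on the product
  have hD1m : Measurable fun p : ℝ × ℝ ↦
      Real.cos p.1 / (Real.cos p.1 ^ 2 + (p.2 - Real.sin p.1) ^ 2) := by fun_prop
  have hD1 : Integrable (fun p : ℝ × ℝ ↦
      Real.cos p.1 / (Real.cos p.1 ^ 2 + (p.2 - Real.sin p.1) ^ 2)) (μ.prod volume) := by
    rw [integrable_prod_iff hD1m.aestronglyMeasurable]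
    constructor
    · rw [hμ]
      filter_upwards [ae_restrict_mem hSm] with θ hθ
      exact (integral_poisson_mass (hcos θ hθ) (Real.sin θ)).1
    · have hconst : ∀ᵐ θ ∂μ, (fun θ ↦ ∫ t, ‖Real.cos θ / (Real.cos θ ^ 2 + (t - Real.sin θ) ^ 2)‖) θ = π := by
        rw [hμ]
        filter_upwards [ae_restrict_mem hSm] with θ hθ
        have hc := hcos θ hθ
        rw [← (integral_poisson_mass hc (Real.sin θ)).2]
        refine integral_congr_ae (ae_of_all _ fun t ↦ ?_)
        simp only
        rw [Real.norm_eq_abs, abs_of_nonneg (div_nonneg hc.le (by positivity))]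
      exact (integrable_congr hconst).2 (integrable_const π)
  have hD2 : Integrable (fun p : ℝ × ℝ ↦ 1 * |g p.2 / (1 + p.2 ^ 2)|) (μ.prod volume) :=
    (integrable_const (1 : ℝ)).mul_prod hg.abs
  have hDint : Integrable D (μ.prod volume) := by
    simp only [hD]
    exact (hD1.const_mul _).add (hD2.const_mul _)
  have hfint : Integrable f (μ.prod volume) := by
    refine hDint.mono' hfm ?_
    have hS1 : ∀ᵐ θ ∂μ, θ ∈ S := by rw [hμ]; exact ae_restrict_mem hSm
    have : ∀ᵐ p ∂(μ.prod (volume : Measure ℝ)), p.1 ∈ S :=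
      (Measure.quasiMeasurePreserving_fst (μ := μ) (ν := (volume : Measure ℝ))).ae hS1
    filter_upwards [this] with p hp
    exact hbound p hp
  -- the inner `t`-integral for `θ ∈ S`
  have hinner : ∀ θ ∈ S, ∫ t, f (θ, t) = Real.cos θ *
      ((∫ t : ℝ, (π⁻¹ * (-(cexp (θ * I)) / ((cexp (θ * I)) - t * I) ^ 2).re) * g t) +
        ∫ t : ℝ, (π⁻¹ * (1 / ((cexp (θ * I)) - t * I)).re) * g t) := by
    intro θ hθ
    have he : 0 < (cexp (θ * I)).re := by rw [expI_re]; exact hcos θ hθ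
    obtain ⟨hP, hdP, -⟩ := hasDerivAt_poissonIntegral hgm hg he
    simp only [hf]
    rw [← integral_add hdP hP, ← MeasureTheory.integral_const_mul]
    refine integral_congr_ae (ae_of_all _ fun t ↦ ?_)
    ring
  -- the inner `θ`-integral for `|t| ≠ 1`
  have hinner' : ∀ t : ℝ, |t| ≠ 1 → ∫ θ, f (θ, t) ∂μ =
      Set.indicator {t : ℝ | 1 < |t|} (fun t ↦ g t / t ^ 2) t := by
    intro t ht
    simp only [hf]
    rw [MeasureTheory.integral_mul_const, hμ, hS, ← integral_Ioc_eq_integral_Ioo,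
      ← intervalIntegral.integral_of_le hpi, integral_arcKernel ht]
    by_cases h : 1 < |t|
    · rw [if_pos h, Set.indicator_of_mem (by exact h)]
      ring
    · rw [if_neg h, Set.indicator_of_notMem (by exact h), zero_mul]
  refine ⟨?_, ?_⟩
  · -- integrability in `θ`
    have h1 : IntegrableOn (fun θ ↦ ∫ t, f (θ, t)) S volume := hfint.integral_prod_left
    rw [intervalIntegrable_iff_integrableOn_Ioo_of_le hpi]
    exact IntegrableOn.congr_fun h1 (fun θ hθ ↦ hinner θ hθ) hSm
  · -- Fubini
    have hswap := integral_integral_swap (f := fun θ t ↦ f (θ, t)) (μ := μ) (ν := volume) hfint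
    have hL : ∫ θ in (-(π / 2))..(π / 2), Real.cos θ *
        ((∫ t : ℝ, (π⁻¹ * (-(cexp (θ * I)) / ((cexp (θ * I)) - t * I) ^ 2).re) * g t) +
          ∫ t : ℝ, (π⁻¹ * (1 / ((cexp (θ * I)) - t * I)).re) * g t) = ∫ θ, ∫ t, f (θ, t) ∂volume ∂μ := by
      rw [intervalIntegral.integral_of_le hpi, integral_Ioc_eq_integral_Ioo, hμ, hS]
      exact (setIntegral_congr_fun hSm fun θ hθ ↦ (hinner θ hθ).symm)
    rw [hL, hswap]
    have hae : ∀ᵐ t ∂(volume : Measure ℝ), t ∉ ({1, -1} : Set ℝ) :=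
      measure_eq_zero_iff_ae_notMem.1 ((Set.toFinite _).measure_zero _)
    have hR : ∫ t, ∫ θ, f (θ, t) ∂μ = ∫ t, Set.indicator {t : ℝ | 1 < |t|} (fun t ↦ g t / t ^ 2) t := by
      refine integral_congr_ae ?_
      filter_upwards [hae] with t ht
      refine hinner' t ?_
      intro h1
      apply ht
      rcases abs_eq (zero_le_one) |>.1 h1 with h | h
      · exact Or.inl h
      · exact Or.inr h
    rw [hR, MeasureTheory.integral_indicator (measurableSet_lt measurable_const continuous_abs.measurable)]

end WangArc

end Literature.NumberTheory.LFunctions
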